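import Mathlib
import HarnessLib
import Literature.AlgebraicGeometry.Ramification.InertiaNormalSylow
import Literature.AlgebraicGeometry.Ramification.NormalSylowExtensions
import Summits.ResolutionOfSingularities.ResolutionOfSingularities.Theorems.WildQuotientsWildQuotientResolutionFlagStep

/-!
# A finite linear group of a plane stabilising a line is p-closed (Phase 0 tower analysis, linear form of the Borel argument; crux `WildQuotients.WildQuotientResolution`)

Crux stmt-ResolutionOfSingularities-15640 (`WildQuotientResolution`), registered stub
`stub_phaseZeroHighDim`, move-game track. The linear-algebra form of the «Borel» step used all
along the termination analysis (memo `PHASE0-DIM3-TERMINATION.md` §2(c), (T6); the tree's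
`FlagCoreGeneral.hasNormalSylow_of_flag` is the module-over-a-local-ring form): **a finite group of
linear automorphisms of a 2-dimensional vector space over a field of characteristic `p` which
stabilises a line has a normal Sylow `p`-subgroup.** In an adapted basis the group is upper
triangular; the diagonal gives a homomorphism to the commutative group `κˣ × κˣ` (p-closed image,
✓`FlagStep.hasNormalSylow_range_of_comm`), whose kernel consists of unipotent elements `1 + N`,
`N² = 0`, of order dividing `p` — a normal `p`-subgroup (✓`HasNormalSylow.of_isPGroup_of_quotient`).
Contrapositive (the form consumed by ✓`TowerStep` / ✓`TowerStepUnique`): a NON-p-closed finite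
linear group of a plane has NO stable line.

* `hasNormalSylow_of_stable_line` — the theorem, for a finite subgroup of `V ≃ₗ[κ] V`.
* `no_stable_line_of_not_hasNormalSylow` — contrapositive.

[OURS · crux stmt-ResolutionOfSingularities-15640 · helper toward `stub_phaseZeroHighDim`
(termination of the point-move towers, dim 3); folklore linear algebra, counted 0; AI-level work,
weaker than expert review.]
-/

-- single-problem summit: the doubled namespace component `ResolutionOfSingularities` is forced
set_option linter.dupNamespace false

open Literature.AlgebraicGeometry.Ramification
open Summit.ResolutionOfSingularities.ResolutionOfSingularities.Theorems.WildQuotientResolution.FlagStep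

namespace Summit.ResolutionOfSingularities.ResolutionOfSingularities.Theorems.WildQuotientResolution.TowerStep

set_option maxHeartbeats 800000 in
/-- **A finite linear group of a plane stabilising a line is p-closed.** `κ` a field of
characteristic `p`, `V` a `κ`-plane, `Γ ≤ GL(V)` finite with a `Γ`-stable line `L`. Then `Γ` has
a normal Sylow `p`-subgroup: with a basis `v₁ ∈ L`, `v₂ ∉ L`, `g v₁ = c₁(g) v₁`,
`g v₂ = a(g) v₁ + c₂(g) v₂`; `g ↦ (c₁(g), c₂(g)) ∈ κˣ × κˣ` is a homomorphism with p-closed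
(commutative) image and its kernel is killed by `p` (`g = 1 + N`, `N² = 0`, `g^p = 1 + pN = 1`),
hence is a normal `p`-subgroup. [folklore] -/
theorem hasNormalSylow_of_stable_line {p : ℕ} [hp : Fact p.Prime] {κ V : Type*} [Field κ]
    [CharP κ p] [AddCommGroup V] [Module κ V] [FiniteDimensional κ V]
    (h2 : Module.finrank κ V = 2) (Γ : Subgroup (V ≃ₗ[κ] V)) [Finite Γ]
    (L : Submodule κ V) (hL : Module.finrank κ L = 1)
    (hstab : ∀ g ∈ Γ, ∀ v ∈ L, g v ∈ L) : HasNormalSylow p Γ := by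
  classical
  -- ### an adapted basis `v₁ ∈ L`, `v₂ ∉ L`
  obtain ⟨w₁, hw₁0, hw₁⟩ := finrank_eq_one_iff'.mp hL
  set v₁ : V := (w₁ : V) with hv₁def
  have hv₁L : v₁ ∈ L := w₁.2
  have hv₁0 : v₁ ≠ 0 := fun h => hw₁0 (Subtype.ext h)
  have hLspan : ∀ v ∈ L, ∃ c : κ, c • v₁ = v := fun v hv => by
    obtain ⟨c, hc⟩ := hw₁ ⟨v, hv⟩
    exact ⟨c, by have := congrArg Subtype.val hc; simpa using this⟩
  have hLne : L ≠ ⊤ := by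
    intro h
    rw [h, finrank_top, h2] at hL
    exact absurd hL (by decide)
  obtain ⟨v₂, hv₂⟩ : ∃ v₂ : V, v₂ ∉ L := by
    by_contra hall
    exact hLne (Submodule.eq_top_iff'.mpr fun v => by
      by_contra hv
      exact hall ⟨v, hv⟩)
  have hli : LinearIndependent κ ![v₁, v₂] := by
    refine LinearIndependent.pair_iff.mpr fun s t hst => ?_
    have ht : t = 0 := by
      by_contra ht
      apply hv₂
      have : v₂ = -(t⁻¹ * s) • v₁ := by
        have h1 : t • v₂ = -(s • v₁) := eq_neg_of_add_eq_zero_right hst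
        calc v₂ = t⁻¹ • (t • v₂) := by rw [smul_smul, inv_mul_cancel₀ ht, one_smul]
          _ = -(t⁻¹ * s) • v₁ := by rw [h1, smul_neg, smul_smul, neg_smul]
      rw [this]
      exact L.smul_mem _ hv₁L
    rw [ht, zero_smul, add_zero, smul_eq_zero] at hst
    exact ⟨hst.resolve_right hv₁0, ht⟩
  let b : Module.Basis (Fin 2) κ V :=
    basisOfLinearIndependentOfCardEqFinrank hli (by rw [Fintype.card_fin, h2])
  have hb0 : b 0 = v₁ := by
    rw [coe_basisOfLinearIndependentOfCardEqFinrank]; rfl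
  have hb1 : b 1 = v₂ := by
    rw [coe_basisOfLinearIndependentOfCardEqFinrank]; rfl
  -- coordinates
  have hexp : ∀ v : V, v = b.coord 0 v • v₁ + b.coord 1 v • v₂ := fun v => by
    conv_lhs => rw [← b.sum_repr v]
    rw [Fin.sum_univ_two, hb0, hb1]
    rfl
  have hc00 : b.coord 0 v₁ = 1 := by
    rw [← hb0]; simp [Module.Basis.coord_apply, b.repr_self]
  have hc10 : b.coord 1 v₁ = 0 := by
    rw [← hb0]; simp [Module.Basis.coord_apply, b.repr_self]
  have hc01 : b.coord 0 v₂ = 0 := by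
    rw [← hb1]; simp [Module.Basis.coord_apply, b.repr_self]
  have hc11 : b.coord 1 v₂ = 1 := by
    rw [← hb1]; simp [Module.Basis.coord_apply, b.repr_self]
  -- for `g ∈ Γ`: `g v₁ = c₁ • v₁` (second coordinate `0`)
  have hgv₁ : ∀ g : Γ, b.coord 1 ((g : V ≃ₗ[κ] V) v₁) = 0 ∧
      (g : V ≃ₗ[κ] V) v₁ = b.coord 0 ((g : V ≃ₗ[κ] V) v₁) • v₁ := by
    intro g
    obtain ⟨c, hc⟩ := hLspan _ (hstab g g.2 v₁ hv₁L)
    have h1 : b.coord 1 ((g : V ≃ₗ[κ] V) v₁) = 0 := by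
      rw [← hc, map_smul, smul_eq_mul, hc10, mul_zero]
    refine ⟨h1, ?_⟩
    conv_lhs => rw [hexp ((g : V ≃ₗ[κ] V) v₁)]
    rw [h1, zero_smul, add_zero]
  -- the diagonal entries are non-zero
  have hc₁ne : ∀ g : Γ, b.coord 0 ((g : V ≃ₗ[κ] V) v₁) ≠ 0 := by
    intro g h
    have : (g : V ≃ₗ[κ] V) v₁ = 0 := by rw [(hgv₁ g).2, h, zero_smul]
    exact hv₁0 ((g : V ≃ₗ[κ] V).map_eq_zero_iff.mp this)
  have hc₂ne : ∀ g : Γ, b.coord 1 ((g : V ≃ₗ[κ] V) v₂) ≠ 0 := by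
    intro g h
    apply hv₂
    have hgv₂L : (g : V ≃ₗ[κ] V) v₂ ∈ L := by
      rw [hexp ((g : V ≃ₗ[κ] V) v₂), h, zero_smul, add_zero]
      exact L.smul_mem _ hv₁L
    have := hstab _ (g⁻¹).2 _ hgv₂L
    simpa using this
  -- ### the diagonal character `χ : Γ → κˣ × κˣ`
  let χ₀ : Γ → κˣ × κˣ := fun g =>
    (Units.mk0 _ (hc₁ne g), Units.mk0 _ (hc₂ne g))
  have hmul : ∀ g h : Γ, χ₀ (g * h) = χ₀ g * χ₀ h := by
    intro g h
    have hgh : ((g * h : Γ) : V ≃ₗ[κ] V) = (g : V ≃ₗ[κ] V) * (h : V ≃ₗ[κ] V) := rfl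
    ext
    · -- first diagonal entry
      change b.coord 0 (((g * h : Γ) : V ≃ₗ[κ] V) v₁) =
        b.coord 0 ((g : V ≃ₗ[κ] V) v₁) * b.coord 0 ((h : V ≃ₗ[κ] V) v₁)
      have e1 : ((g * h : Γ) : V ≃ₗ[κ] V) v₁ =
          b.coord 0 ((h : V ≃ₗ[κ] V) v₁) • (g : V ≃ₗ[κ] V) v₁ := by
        rw [hgh, LinearEquiv.mul_apply]
        conv_lhs => rw [(hgv₁ h).2]
        rw [map_smul]
      rw [e1, map_smul, smul_eq_mul, mul_comm]
    · -- second diagonal entry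
      change b.coord 1 (((g * h : Γ) : V ≃ₗ[κ] V) v₂) =
        b.coord 1 ((g : V ≃ₗ[κ] V) v₂) * b.coord 1 ((h : V ≃ₗ[κ] V) v₂)
      rw [hgh, LinearEquiv.mul_apply]
      conv_lhs => rw [hexp ((h : V ≃ₗ[κ] V) v₂)]
      rw [map_add, map_smul, map_smul, map_add, map_smul, map_smul, smul_eq_mul, smul_eq_mul,
        (hgv₁ g).1, mul_zero, zero_add, mul_comm]
  let χ : Γ →* κˣ × κˣ := MonoidHom.mk' χ₀ hmul
  -- ### the kernel is killed by `p`
  have hker : ∀ g : Γ, χ g = 1 → g ^ p = 1 := by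
    intro g hg
    have h01 : b.coord 0 ((g : V ≃ₗ[κ] V) v₁) = 1 := by
      have := congrArg (fun u : κˣ × κˣ => (u.1 : κ)) hg
      simpa [χ, χ₀] using this
    have h12 : b.coord 1 ((g : V ≃ₗ[κ] V) v₂) = 1 := by
      have := congrArg (fun u : κˣ × κˣ => (u.2 : κ)) hg
      simpa [χ, χ₀] using this
    have hg1 : (g : V ≃ₗ[κ] V) v₁ = v₁ := by rw [(hgv₁ g).2, h01, one_smul]
    set a : κ := b.coord 0 ((g : V ≃ₗ[κ] V) v₂) with ha
    have hg2 : (g : V ≃ₗ[κ] V) v₂ = a • v₁ + v₂ := by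
      conv_lhs => rw [hexp ((g : V ≃ₗ[κ] V) v₂)]
      rw [h12, one_smul]
    -- `g^n v₁ = v₁`, `g^n v₂ = (n a) • v₁ + v₂`
    have hpow : ∀ n : ℕ, ((g : V ≃ₗ[κ] V) ^ n) v₁ = v₁ ∧
        ((g : V ≃ₗ[κ] V) ^ n) v₂ = ((n : κ) * a) • v₁ + v₂ := by
      intro n
      induction n with
      | zero => simp
      | succ n ih =>
        rw [pow_succ, LinearEquiv.mul_apply, LinearEquiv.mul_apply, hg1, ih.1, hg2, map_add,
          map_smul, ih.1, ih.2, Nat.cast_succ]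
        refine ⟨rfl, ?_⟩
        rw [add_mul, one_mul, add_smul, add_comm (((n : κ) * a) • v₁) (a • v₁), add_assoc]
    have hgp : ((g : V ≃ₗ[κ] V) ^ p) = 1 := by
      refine b.ext' fun i => ?_
      fin_cases i
      · change ((g : V ≃ₗ[κ] V) ^ p) (b 0) = (1 : V ≃ₗ[κ] V) (b 0)
        rw [hb0, (hpow p).1]; rfl
      · change ((g : V ≃ₗ[κ] V) ^ p) (b 1) = (1 : V ≃ₗ[κ] V) (b 1)
        rw [hb1, (hpow p).2, CharP.cast_eq_zero, zero_mul, zero_smul, zero_add]; rfl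
    exact Subtype.ext (by rw [Subgroup.coe_pow, hgp]; rfl)
  have hK : IsPGroup p χ.ker := by
    intro k
    refine ⟨1, ?_⟩
    rw [pow_one]
    exact Subtype.ext (hker k.1 k.2)
  -- ### conclusion
  haveI : Finite χ.range := Finite.of_surjective χ.rangeRestrict χ.rangeRestrict_surjective
  have hQ : HasNormalSylow p (Γ ⧸ χ.ker) :=
    (hasNormalSylow_range_of_comm (p := p) χ).of_mulEquiv (QuotientGroup.quotientKerEquivRange χ).symm
  exact HasNormalSylow.of_isPGroup_of_quotient χ.ker hK hQ

/-- **Contrapositive: a non-p-closed finite linear group of a plane has no stable line** — the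
hypothesis «`W` has no stable line» of ✓`TowerStep.isCompl_of_stable_line_of_finrank_quotient_eq_one`
and ✓`TowerStepUnique.eq_of_stable_lines_of_no_stable_line`, produced from «the image of the inertia
on the plane is not p-closed» (✓`FlagStepPoint`, contrapositive). [folklore] -/
theorem no_stable_line_of_not_hasNormalSylow {p : ℕ} [Fact p.Prime] {κ V : Type*} [Field κ]
    [CharP κ p] [AddCommGroup V] [Module κ V] [FiniteDimensional κ V]
    (h2 : Module.finrank κ V = 2) (Γ : Subgroup (V ≃ₗ[κ] V)) [Finite Γ]
    (hΓ : ¬ HasNormalSylow p Γ) (L : Submodule κ V) (hL : Module.finrank κ L = 1) :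
    ∃ g ∈ Γ, ∃ v ∈ L, g v ∉ L := by
  by_contra h
  refine hΓ (hasNormalSylow_of_stable_line h2 Γ L hL fun g hg v hv => ?_)
  by_contra hgv
  exact h ⟨g, hg, v, hv, hgv⟩

end Summit.ResolutionOfSingularities.ResolutionOfSingularities.Theorems.WildQuotientResolution.TowerStep
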